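import Summits.ResolutionOfSingularities.ResolutionOfSingularities.Theorems.FrobeniusClosingSteerHevLeafMax
import Summits.ResolutionOfSingularities.ResolutionOfSingularities.Theorems.FrobeniusClosingSteerSteeredRebase
import Summits.ResolutionOfSingularities.ResolutionOfSingularities.Theorems.FrobeniusClosingSteerWords17ALandedLeaves
import Summits.ResolutionOfSingularities.ResolutionOfSingularities.Theorems.FrobeniusClosingSteerOrderInductionWords
import HarnessLib

/-!
# (MAX)ᴵ DROP-SPLIT — what the order-induction binder still buys on the EVEN side after `MaxVacuity` (res-L0-w41-strat-2 g3, MEMO §23 draft;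
  SIGNATURES + PROVED glue + PROVED member lemma; 0 sorries)

After strat-1 g10ʼs `MaxVacuity.shadowConclInd_holds` the even branch of the hEv leaf is (MAX)ᴵ `StrippingTailSwitchingEvenInfMaxConclIndTwoN` ALONE, and
NOTHING on the even side consumes its last binder `hbelow : OrderInduction.ConclBelowDatum p k K O A₀ t` any more ((SH-NR)ᴵ did, via P5b). This file
records the ONE use that remains, as a split keyed on the START reaching ONE MORE than the eventual even binary degree:

* (MAX-D)ᴵ  `StrippingTailSwitchingEvenInfMaxDropConclIndTwoN`   = (MAX)ᴵ VERBATIM with the binary-residue binder strengthened by the conjunct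
  `OrderInduction.CleanerReaches p O A₀.toSubring t (2 * e + 1)` («the start reaches 2e + 1: the tail degree 2e lies STRICTLY BELOW the startʼs reach — a DROP»).
  KERNEL-CLOSABLE NOW: a late point step `j` carries `BinaryResiduePointStepAt … (2e) j`, whose exactness clause says NO cleaner of `s_j²` reaches `2e + 1`
  in `R j`; re-base the datum at `(A_j, s_j)` (`SteeredRebase.rebase_of_model`, `concl_or_coreDatum`) and apply `hbelow` at `d = 2e + 1` — the member-level
  step is `concl_of_exact_member_of_startReach` BELOW (PROVED; P5bʼs `concl_of_shadow_member` with `s'' := s`, LEMMA N replaced by the exactness clause);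
  the run-level plumbing ((I2) members regular, (I4) `GenAt (R j) 2 t (s j)`, (I5) a model `A_j` of `R j`) is res-D-lib-2ʼs `shNR_holds` package verbatim.
* (MAX-ND)ᴵ `StrippingTailSwitchingEvenInfMaxNoDropConclIndTwoN` = the same with `¬ OrderInduction.CleanerReaches … (2 * e + 1)` («NO DROP: the eventual degree
  2e dominates every order the start reaches») = THE FRONTIER. Inhabitants of record: W10⁺ (5 → 10), W8⁺ (3 → 8), W10/W14e, the N-family (start in key form,
  4 = 2e) — all NO-DROP, all `Concl` TRUE by toric exit (tri-1 v6.33, brk-2 `SteerToricVertexExit`, idea-2 (CERT-2)).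
* GLUE (PROVED): (MAX)ᴵ ⟸ (MAX-D)ᴵ ∧ (MAX-ND)ᴵ, excluded middle on the reach.

SR-6-safe: the start key appears only as a HYPOTHESIS of the closable half; no word claims the start reaches anything. OURS; candidates, not facts.
-/

-- `Summit.<S>.<S>.…` duplicates the summit name by design (single-problem summit).
set_option linter.dupNamespace false

open IsLocalRing
open Literature.AlgebraicGeometry.Resolution
open Summit.ResolutionOfSingularities.ResolutionOfSingularities.Theorems.SwitchingDichotomy.Words
open Summit.ResolutionOfSingularities.ResolutionOfSingularities.Theorems.SteerRankThinness (Concl HasProperCoarsening)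
open Summit.ResolutionOfSingularities.ResolutionOfSingularities.Theorems.SwitchingDichotomy.ArithReduction
open Summit.ResolutionOfSingularities.ResolutionOfSingularities.Theorems.SwitchingDichotomy

namespace Summit.ResolutionOfSingularities.ResolutionOfSingularities.Theorems.SwitchingDichotomy.HevLeaf

namespace DropSplit

variable {K : Type} [Field K]

/-- **(MAX-D)ᴵ `StrippingTailSwitchingEvenInfMaxDropConclIndTwoN`** — (MAX)ᴵ VERBATIM, binary-residue binder strengthened by «the START reaches `2e + 1`»
(a DROP into the eventual even degree). Kernel-closable now from `hbelow` (header). OURS. (folklore) -/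
def StrippingTailSwitchingEvenInfMaxDropConclIndTwoN : Prop :=
  ∀ p : ℕ, p = 2 →
    ∀ (k K : Type) [Field k] [CharP k p] [PerfectField k] [Field K] [Algebra k K]
    (O : ValuationSubring K) (A₀ : Subalgebra k K) (h₀ : A₀.toSubring ≤ O.toSubring) (t : K),
    CoreDatum p 4 k K O A₀ h₀ t → ¬ HasProperCoarsening O →
    ∀ (R : ℕ → Subring K) (P : (i : ℕ) → Ideal (R i)) (s : ℕ → K),
      R 0 = locAtCentre A₀.toSubring O → NormalAt O (R 0) p t → IsSteeredRun O R P t p s →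
      (¬ ∃ i₀ c : ℕ, 1 ≤ c ∧ IsDominantTail R P i₀ c) →
      (∃ i₀ : ℕ, ∀ i, i₀ ≤ i → IsHighOrderAt R s p i) →
      ¬ HeightTwoStepsInfinite R P → {j | IsPosStep R P j}.Infinite →
      (∀ i₀ : ℕ, ∃ i, i₀ ≤ i ∧ IsPointStep R P i ∧
        ∀ hs : s i ^ p ∈ R i, ¬ HasIsolatedSingularity (RadicandRing (R i) p ⟨s i ^ p, hs⟩)) →
      (¬ ∃ i₀ : ℕ, ∃ x : K, x ≠ 0 ∧ x ∈ O ∧ O.valuation x < 1 ∧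
        ∀ i, i₀ ≤ i → ∀ y ∈ R i, O.valuation y < 1 → ∃ j, i < j ∧ y / x ∈ R j) →
      (∃ i₀ : ℕ, ∀ i, i₀ ≤ i → ¬ OddCleanedPointStepAt R P s p i) →
      (∃ i₀ e : ℕ, 2 ≤ e ∧ (∀ i, i₀ ≤ i → IsPointStep R P i → BinaryResiduePointStepAt R P s p (2 * e) i) ∧
        OrderInduction.CleanerReaches p O A₀.toSubring t (2 * e + 1)) →
      (∀ i₀ : ℕ, ∃ i i' : ℕ, i₀ ≤ i ∧ IsSatellitePair R P i i') →
      (∃ i₀ : ℕ, ∀ i i' : ℕ, i₀ ≤ i → IsSatellitePair R P i i' → ¬ NoSingularSurfaceAt R s p i') →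
      (∃ i₀ : ℕ, ∀ i, i₀ ≤ i → IsPointStep R P i → IsMaxGenAt (R i) p t (s i)) →
      OrderInduction.ConclBelowDatum p k K O A₀ t →
      Concl O A₀ t

/-- **(MAX-ND)ᴵ `StrippingTailSwitchingEvenInfMaxNoDropConclIndTwoN`** — (MAX)ᴵ VERBATIM, binary-residue binder strengthened by «the START does NOT reach
`2e + 1`» (NO DROP: the eventual even degree dominates the startʼs reach). THE FRONTIER of the even branch (header: every inhabitant of record lives here,
each with `Concl` TRUE by toric exit). Why it might fail: it is the open problem of the leaf. OURS. (folklore) -/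
def StrippingTailSwitchingEvenInfMaxNoDropConclIndTwoN : Prop :=
  ∀ p : ℕ, p = 2 →
    ∀ (k K : Type) [Field k] [CharP k p] [PerfectField k] [Field K] [Algebra k K]
    (O : ValuationSubring K) (A₀ : Subalgebra k K) (h₀ : A₀.toSubring ≤ O.toSubring) (t : K),
    CoreDatum p 4 k K O A₀ h₀ t → ¬ HasProperCoarsening O →
    ∀ (R : ℕ → Subring K) (P : (i : ℕ) → Ideal (R i)) (s : ℕ → K),
      R 0 = locAtCentre A₀.toSubring O → NormalAt O (R 0) p t → IsSteeredRun O R P t p s →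
      (¬ ∃ i₀ c : ℕ, 1 ≤ c ∧ IsDominantTail R P i₀ c) →
      (∃ i₀ : ℕ, ∀ i, i₀ ≤ i → IsHighOrderAt R s p i) →
      ¬ HeightTwoStepsInfinite R P → {j | IsPosStep R P j}.Infinite →
      (∀ i₀ : ℕ, ∃ i, i₀ ≤ i ∧ IsPointStep R P i ∧
        ∀ hs : s i ^ p ∈ R i, ¬ HasIsolatedSingularity (RadicandRing (R i) p ⟨s i ^ p, hs⟩)) →
      (¬ ∃ i₀ : ℕ, ∃ x : K, x ≠ 0 ∧ x ∈ O ∧ O.valuation x < 1 ∧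
        ∀ i, i₀ ≤ i → ∀ y ∈ R i, O.valuation y < 1 → ∃ j, i < j ∧ y / x ∈ R j) →
      (∃ i₀ : ℕ, ∀ i, i₀ ≤ i → ¬ OddCleanedPointStepAt R P s p i) →
      (∃ i₀ e : ℕ, 2 ≤ e ∧ (∀ i, i₀ ≤ i → IsPointStep R P i → BinaryResiduePointStepAt R P s p (2 * e) i) ∧
        ¬ OrderInduction.CleanerReaches p O A₀.toSubring t (2 * e + 1)) →
      (∀ i₀ : ℕ, ∃ i i' : ℕ, i₀ ≤ i ∧ IsSatellitePair R P i i') →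
      (∃ i₀ : ℕ, ∀ i i' : ℕ, i₀ ≤ i → IsSatellitePair R P i i' → ¬ NoSingularSurfaceAt R s p i') →
      (∃ i₀ : ℕ, ∀ i, i₀ ≤ i → IsPointStep R P i → IsMaxGenAt (R i) p t (s i)) →
      OrderInduction.ConclBelowDatum p k K O A₀ t →
      Concl O A₀ t

/-- **GLUE (PROVED, pure logic): (MAX)ᴵ ⟸ (MAX-D)ᴵ ∧ (MAX-ND)ᴵ** — excluded middle on «the start reaches `2e + 1`» for the `e` of the binary-residue binder.
OURS. (folklore) -/
theorem strippingTailSwitchingEvenInfMaxConclIndTwoN_of_drop_of_noDrop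
    (hD : StrippingTailSwitchingEvenInfMaxDropConclIndTwoN) (hND : StrippingTailSwitchingEvenInfMaxNoDropConclIndTwoN) :
    StrippingTailSwitchingEvenInfMaxConclIndTwoN := by
  intro p hp2 k K _ _ _ _ _ O A₀ h₀ t core hrk R P s hR0 hN hrun hnd hhigh h2 hinf hwild hsw hev hbin hsat hsing hmax hbelow
  obtain ⟨i₀, e, he, hb⟩ := hbin
  by_cases hreach : OrderInduction.CleanerReaches p O A₀.toSubring t (2 * e + 1)
  · exact hD p hp2 k K O A₀ h₀ t core hrk R P s hR0 hN hrun hnd hhigh h2 hinf hwild hsw hev ⟨i₀, e, he, hb, hreach⟩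
      hsat hsing hmax hbelow
  · exact hND p hp2 k K O A₀ h₀ t core hrk R P s hR0 hN hrun hnd hhigh h2 hinf hwild hsw hev ⟨i₀, e, he, hb, hreach⟩
      hsat hsing hmax hbelow

/-- **MEMBER LEMMA (PROVED) `concl_of_exact_member_of_startReach`** — the member-level step of (MAX-D)ᴵ: at a member `R = locAtCentre A₁ O` (f.g. `A₁ ⊇ A₀`),
regular, with generator `s` (`GenAt R 2 t s`) such that NO cleaner of `s²` reaches order `d` in `R`, while the START radicand reaches `d`: the inductive binder
`ConclBelowDatum 2 k K O A₀ t` gives `Concl O A₀ t`. (P5b `MaxGenShadow.Run.concl_of_shadow_member` with `s'' := s`; LEMMA N replaced by the hypothesis `hE`;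
assembly of `SteeredRebase.rebase_of_model`, `concl_or_coreDatum`, the binder at `d`, and the `Concl`-transfer.) OURS. (folklore) -/
theorem concl_of_exact_member_of_startReach {k : Type} [Field k] [CharP k 2] [PerfectField k] [Algebra k K]
    (O : ValuationSubring K) (A₀ : Subalgebra k K) (h₀ : A₀.toSubring ≤ O.toSubring) (t : K)
    (core : CoreDatum 2 4 k K O A₀ h₀ t) (hbelow : OrderInduction.ConclBelowDatum 2 k K O A₀ t)
    (R : Subring K) [IsLocalRing R] (A₁ : Subalgebra k K) (h₁ : A₁.toSubring ≤ O.toSubring) (hA₀A₁ : A₀ ≤ A₁)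
    (hfg₁ : A₁.FG) (hR : locAtCentre A₁.toSubring O = R) (hI2 : IsRegularLocalRing R)
    {s : K} (hI4 : GenAt R 2 t s) {d : ℕ} (hE : ∀ g : R, (⟨s ^ 2, hI4.1⟩ : R) - g ^ 2 ∉ maximalIdeal R ^ d)
    (hstart : OrderInduction.CleanerReaches 2 O A₀.toSubring t d) :
    Concl O A₀ t := by
  classical
  obtain ⟨hfg, htp, hfr, hreg, hmax, hzd, hdim2, hA, hdense, hD, hδ, hpow, htr, hS⟩ := core
  -- re-base the datum at the generator `s` itself
  obtain ⟨A', h', hA₀A', hRA', hfg', hwpA', htA', hfr', hreg', htransfer⟩ :=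
    SteeredRebase.rebase_of_model O A₀ A₁ h₁ hA₀A₁ hfg₁ R hR t s 2 hfr hI4.1 hI4.2 hI2
  -- the transfer `Concl O A' s → Concl O A₀ t`
  have hback : Concl O A' s → Concl O A₀ t := by
    rintro ⟨A, h, hA'A, hsA, hAfg, hAfrac, hAreg⟩
    obtain ⟨B, hB, hA₀B, htB, hBfg, hBfrac, hBreg⟩ := htransfer ⟨A, h, hA'A, hsA, hAfg, hAfrac, hAreg⟩
    exact ⟨B, hB, hA₀B, htB, hBfg, hBfrac, hBreg⟩
  -- `Concl ∨ CoreDatum` at the re-based datum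
  rcases concl_or_coreDatum 2 Nat.prime_two 4 k K O A' h' s htr hzd hfg' hwpA' hfr' hreg' with hc | core'
  · exact hback hc
  · -- the START reaches `d` (binder `hstart`), the re-based datum does not: its centre ring IS `R`, where `hE` forbids it
    apply hback
    refine hbelow A' h' s core' ⟨d, hstart, ?_⟩
    rintro ⟨hloc, hs2, g, hg⟩
    subst hRA'
    exact hE g (by simpa using hg)

end DropSplit

end Summit.ResolutionOfSingularities.ResolutionOfSingularities.Theorems.SwitchingDichotomy.HevLeaf
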